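import Literature.Analysis.FluidPDE.LerayHopfProofs
import Literature.Analysis.FluidPDE.WholeSpaceIBP
import Literature.Analysis.FluidPDE.PeriodicLerayProfileGradient
import Mathlib.Analysis.SpecialFunctions.JapaneseBracket

/-!
# K54 (1/4): the profile `U(x) = (1+|x|²)⁻² (-x₁, x₀, 0)`

Cell `ns-blowup`, seat `ns-blowup-refuter4` (g0), KILLSHEET §XXV row K54, part 1/4 of the kernel certificate
`¬ Literature.Analysis.FluidPDE.sohr2001_serrinMasuda_uniqueness_forced(_memLp)` (final file
`SohrForcedUniquenessCountableJunk.lean` in this directory, which carries the full account). LABEL: refuter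
construction (explicit data + proved lemmas; no named facts, no `sorry`). WHAT THIS IS NOT: not Navier–Stokes
evidence; nothing here mentions the summit.

Content: the vector field `swirl : ℝ³ → ℝ³`, `U(x) = (1+|x|²)⁻² J x` with `J x = (-x₁, x₀, 0)`: smooth,
pointwise divergence free (`J x ⊥ x`, `tr J = 0`), `|U(x)| ≤ (1+|x|²)^(-3/2) ≤ 2`, so `U ∈ L^p(ℝ³)` for every
`2 ≤ p < ∞` (Japanese bracket), `|∇U(x)|²_F ≤ 75 (1+|x|²)⁻³` so `∫ |∇U|²_F < ∞`, `∫⟪U,U⟫ > 0`, and — the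
point of the choice — `U` is NOT compactly supported: for every compact `K` there is a point outside `K`
where `U ≠ 0` (`exists_swirl_ne_zero_not_mem`). [folklore]
-/

noncomputable section

namespace Summit.NavierStokesRegularity.ForcedUniquenessCountableJunk

open MeasureTheory Set Filter Topology Function
open scoped ENNReal NNReal RealInnerProductSpace Laplacian
open Literature.Analysis.FluidPDE

/-! ## §4 The profile `U(x) = (1+|x|²)⁻² (-x₁, x₀, 0)`: smooth, divergence free, in `H¹ ∩ L^p`,
not compactly supported -/

/-- The coordinate unit vectors of `ℝ³`. [folklore] -/
def e (i : Fin 3) : EuclideanSpace ℝ (Fin 3) := EuclideanSpace.single i 1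

/-- Coordinates of the unit vectors. [folklore] -/
@[simp] theorem e_apply (i j : Fin 3) : e i j = if j = i then 1 else 0 := by
  simp [e]

/-- The unit vectors have norm one. [folklore] -/
@[simp] theorem norm_e (i : Fin 3) : ‖e i‖ = 1 := by
  simp [e]

/-- The unit vectors are nonzero. [folklore] -/
theorem e_ne_zero (i : Fin 3) : e i ≠ 0 := by
  intro h
  have := norm_e i
  rw [h, norm_zero] at this
  exact zero_ne_one this

/-- The rotation generator `J x = x₀ e₁ - x₁ e₀ = e₂ × x`, a continuous linear map. [folklore] -/
def rotJ : EuclideanSpace ℝ (Fin 3) →L[ℝ] EuclideanSpace ℝ (Fin 3) :=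
  (EuclideanSpace.proj (0 : Fin 3) : EuclideanSpace ℝ (Fin 3) →L[ℝ] ℝ).smulRight (e 1) -
    (EuclideanSpace.proj (1 : Fin 3) : EuclideanSpace ℝ (Fin 3) →L[ℝ] ℝ).smulRight (e 0)

/-- Unfolding `J`. [folklore] -/
theorem rotJ_apply (x : EuclideanSpace ℝ (Fin 3)) : rotJ x = x 0 • e 1 - x 1 • e 0 := by
  simp [rotJ]

/-- `J x ⊥ x`. [folklore] -/
theorem inner_self_rotJ (x : EuclideanSpace ℝ (Fin 3)) : ⟪x, rotJ x⟫ = 0 := by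
  rw [rotJ_apply, inner_sub_right, inner_smul_right, inner_smul_right]
  simp [e, EuclideanSpace.inner_single_right]
  ring

/-- `|J x| ≤ 2|x|`. [folklore] -/
theorem norm_rotJ_le (x : EuclideanSpace ℝ (Fin 3)) : ‖rotJ x‖ ≤ 2 * ‖x‖ := by
  rw [rotJ_apply]
  have h0 : |x 0| ≤ ‖x‖ := by
    have h := abs_real_inner_le_norm x (e 0)
    simpa [e, EuclideanSpace.inner_single_right] using h
  have h1 : |x 1| ≤ ‖x‖ := by
    have h := abs_real_inner_le_norm x (e 1)
    simpa [e, EuclideanSpace.inner_single_right] using h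
  calc ‖x 0 • e 1 - x 1 • e 0‖ ≤ ‖x 0 • e 1‖ + ‖x 1 • e 0‖ := norm_sub_le _ _
    _ = |x 0| + |x 1| := by simp [norm_smul]
    _ ≤ 2 * ‖x‖ := by linarith

/-- `div J = 0` (`J` is linear and traceless). [folklore] -/
theorem divergence_rotJ (x : EuclideanSpace ℝ (Fin 3)) :
    VectorCalculus.divergence (rotJ : EuclideanSpace ℝ (Fin 3) → EuclideanSpace ℝ (Fin 3)) x = 0 := by
  rw [divergence_eq_sum_inner_fderiv (EuclideanSpace.basisFun (Fin 3) ℝ), rotJ.fderiv]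
  simp [Fin.sum_univ_three, rotJ_apply, e, EuclideanSpace.inner_single_left]

/-- The radial envelope `(1 + |x|²)⁻²`. [folklore] -/
def env (x : EuclideanSpace ℝ (Fin 3)) : ℝ := ((1 + ‖x‖ ^ 2) ^ 2)⁻¹

/-- The envelope is positive. [folklore] -/
theorem env_pos (x : EuclideanSpace ℝ (Fin 3)) : 0 < env x := by
  unfold env; positivity

/-- `(1+|x|²)⁻² ≤ (1+|x|²)⁻¹`. [folklore] -/
theorem env_le (x : EuclideanSpace ℝ (Fin 3)) : env x ≤ (1 + ‖x‖ ^ 2)⁻¹ := by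
  unfold env
  rw [inv_le_inv₀ (by positivity) (by positivity)]
  nlinarith [sq_nonneg ‖x‖]

/-- The envelope is smooth. [folklore] -/
theorem env_contDiff : ContDiff ℝ (⊤ : ℕ∞) env :=
  ((contDiff_const.add (contDiff_norm_sq ℝ)).pow 2).inv fun x => by positivity

/-- The one-variable profile `s ↦ ((1+s)²)⁻¹` has derivative `-2(1+s)/((1+s)²)²`. [folklore] -/
theorem hasDerivAt_profile {r : ℝ} (hr : 0 < 1 + r) :
    HasDerivAt (fun s : ℝ => ((1 + s) ^ 2)⁻¹) (-(2 * (1 + r)) / ((1 + r) ^ 2) ^ 2) r := by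
  have h1 : HasDerivAt (fun s : ℝ => (1 + s) ^ 2) (2 * (1 + r)) r := by
    have h : HasDerivAt (fun s : ℝ => (1 + s) ^ 2) (((2 : ℕ) : ℝ) * (1 + r) ^ (2 - 1) * 1) r :=
      ((hasDerivAt_id' r).const_add 1).pow 2
    refine h.congr_deriv ?_
    norm_num
  exact h1.inv (by positivity)

/-- The derivative of the envelope: `D env(x) v = -4 (1+|x|²)⁻³ ⟪x, v⟫`, as the continuous linear
map `c(x) • ⟪x, ·⟫`. [folklore] -/
theorem hasFDerivAt_env (x : EuclideanSpace ℝ (Fin 3)) :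
    HasFDerivAt env ((-(2 * (1 + ‖x‖ ^ 2)) / ((1 + ‖x‖ ^ 2) ^ 2) ^ 2 * 2) • innerSL ℝ x) x := by
  have h := (hasDerivAt_profile (r := ‖x‖ ^ 2) (by positivity)).comp_hasFDerivAt x
    (hasStrictFDerivAt_norm_sq x).hasFDerivAt
  refine h.congr_fderiv ?_
  ext v
  simp [mul_assoc]

/-- `D env(x) v` is a multiple of `⟪x, v⟫`. [folklore] -/
theorem fderiv_env_apply (x v : EuclideanSpace ℝ (Fin 3)) :
    fderiv ℝ env x v = (-(2 * (1 + ‖x‖ ^ 2)) / ((1 + ‖x‖ ^ 2) ^ 2) ^ 2 * 2) * ⟪x, v⟫ := by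
  rw [(hasFDerivAt_env x).fderiv]
  simp

/-- `‖D env(x)‖ ≤ 4|x| (1+|x|²)⁻³`. [folklore] -/
theorem norm_fderiv_env_le (x : EuclideanSpace ℝ (Fin 3)) :
    ‖fderiv ℝ env x‖ ≤ 4 * ‖x‖ / (1 + ‖x‖ ^ 2) ^ 3 := by
  rw [(hasFDerivAt_env x).fderiv, norm_smul, innerSL_apply_norm]
  have hr : 0 < 1 + ‖x‖ ^ 2 := by positivity
  have hc : ‖(-(2 * (1 + ‖x‖ ^ 2)) / ((1 + ‖x‖ ^ 2) ^ 2) ^ 2 * 2 : ℝ)‖ = 4 / (1 + ‖x‖ ^ 2) ^ 3 := by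
    rw [Real.norm_eq_abs, abs_mul, abs_div, abs_neg, abs_of_pos (by positivity),
      abs_of_pos (by positivity), abs_of_pos (by norm_num : (0:ℝ) < 2)]
    field_simp
    ring
  rw [hc]
  exact le_of_eq (by field_simp)

/-- **The profile** `U(x) = (1+|x|²)⁻² J x`. [folklore] -/
def swirl (x : EuclideanSpace ℝ (Fin 3)) : EuclideanSpace ℝ (Fin 3) := env x • rotJ x

/-- `U` is smooth. [folklore] -/
theorem swirl_contDiff : ContDiff ℝ (⊤ : ℕ∞) swirl := env_contDiff.smul rotJ.contDiff

/-- `U` is continuous. [folklore] -/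
theorem continuous_swirl : Continuous swirl := swirl_contDiff.continuous

/-- `|U(x)| ≤ 2 (1+|x|²)⁻¹`. [folklore] -/
theorem norm_swirl_le (x : EuclideanSpace ℝ (Fin 3)) : ‖swirl x‖ ≤ 2 * (1 + ‖x‖ ^ 2)⁻¹ := by
  rw [swirl, norm_smul, Real.norm_eq_abs, abs_of_pos (env_pos x)]
  have h1 : ‖x‖ ≤ 1 + ‖x‖ ^ 2 := by nlinarith [sq_nonneg (‖x‖ - 1 / 2), norm_nonneg x]
  have hr : 0 < 1 + ‖x‖ ^ 2 := by positivity
  calc env x * ‖rotJ x‖ ≤ ((1 + ‖x‖ ^ 2) ^ 2)⁻¹ * (2 * ‖x‖) :=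
        mul_le_mul_of_nonneg_left (norm_rotJ_le x) (env_pos x).le
    _ ≤ ((1 + ‖x‖ ^ 2) ^ 2)⁻¹ * (2 * (1 + ‖x‖ ^ 2)) := by gcongr
    _ = 2 * (1 + ‖x‖ ^ 2)⁻¹ := by field_simp

/-- `|U| ≤ 2`. [folklore] -/
theorem norm_swirl_le_two (x : EuclideanSpace ℝ (Fin 3)) : ‖swirl x‖ ≤ 2 := by
  refine (norm_swirl_le x).trans ?_
  have : (1 + ‖x‖ ^ 2)⁻¹ ≤ 1 := inv_le_one_of_one_le₀ (by nlinarith [norm_nonneg x])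
  linarith

/-- `U` along the `e₀`-axis: `U(R e₀) = env(R e₀) R e₁`. [folklore] -/
theorem swirl_smul_e0 (R : ℝ) : swirl (R • e 0) = (env (R • e 0) * R) • e 1 := by
  rw [swirl, rotJ_apply]
  simp [smul_smul]

/-- `U(e₀) ≠ 0`. [folklore] -/
theorem swirl_e0_ne_zero : swirl (e 0) ≠ 0 := by
  have h := swirl_smul_e0 1
  rw [one_smul] at h
  rw [h]
  exact smul_ne_zero (mul_ne_zero (env_pos _).ne' one_ne_zero) (e_ne_zero 1)

/-- **`U` is not compactly supported**: outside every compact set there is a point with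
`U ≠ 0`. [folklore] -/
theorem exists_swirl_ne_zero_not_mem {K : Set (EuclideanSpace ℝ (Fin 3))} (hK : IsCompact K) :
    ∃ x ∉ K, swirl x ≠ 0 := by
  obtain ⟨R, hR⟩ := hK.isBounded.exists_norm_le
  refine ⟨(|R| + 1) • e 0, fun h => ?_, ?_⟩
  · have h1 := hR _ h
    rw [norm_smul, norm_e, mul_one, Real.norm_eq_abs, abs_of_pos (by positivity)] at h1
    linarith [le_abs_self R]
  · rw [swirl_smul_e0]
    exact smul_ne_zero (mul_ne_zero (env_pos _).ne' (by positivity)) (e_ne_zero 1)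

/-- **`div U = 0`**: `div (env J) = env div J + ⟪J x, ∇env⟫ = 0 + c ⟪x, J x⟫ = 0`. [folklore] -/
theorem swirl_isDivFree : VectorCalculus.IsDivFree swirl := by
  intro x
  have hd : DifferentiableAt ℝ env x := (hasFDerivAt_env x).differentiableAt
  rw [show swirl = fun y => env y • rotJ y from rfl, divergence_smul_apply hd
    (rotJ.differentiableAt), divergence_rotJ, mul_zero, zero_add, real_inner_comm, gradient,
    InnerProductSpace.toDual_symm_apply, fderiv_env_apply, inner_self_rotJ, mul_zero]

/-- `U` is `C¹`. [folklore] -/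
theorem swirl_contDiff_one : ContDiff ℝ 1 swirl := swirl_contDiff.of_le (by exact_mod_cast le_top)

/-- **`U` is weakly divergence free** (tree: `IsDivFree.isWeaklyDivFree_holds`). [folklore] -/
theorem swirl_isWeaklyDivFree : IsWeaklyDivFree swirl :=
  VectorCalculus.IsDivFree.isWeaklyDivFree_holds swirl_isDivFree swirl_contDiff_one

/-- `x ↦ (1+|x|²)⁻¹ ∈ L^p(ℝ³)` for `2 ≤ p < ∞` (Japanese bracket, `2p > 3`). [folklore] -/
theorem memLp_inv_one_add_norm_sq {p : ℝ≥0∞} (hp : 2 ≤ p) (hp' : p ≠ ∞) :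
    MemLp (fun x : EuclideanSpace ℝ (Fin 3) => (1 + ‖x‖ ^ 2)⁻¹) p volume := by
  have hp0 : p ≠ 0 := by
    intro h; rw [h] at hp; exact absurd hp (by simp)
  have hcont : Continuous fun x : EuclideanSpace ℝ (Fin 3) => (1 + ‖x‖ ^ 2)⁻¹ :=
    (continuous_const.add (continuous_norm.pow 2)).inv₀ fun x =>
      (by positivity : (0 : ℝ) < 1 + ‖x‖ ^ 2).ne'
  rw [← integrable_norm_rpow_iff hcont.aestronglyMeasurable hp0 hp']
  have h2 : (2 : ℝ) ≤ p.toReal := by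
    have h := ENNReal.toReal_mono hp' hp
    simpa using h
  have hq : ((Module.finrank ℝ (EuclideanSpace ℝ (Fin 3)) : ℕ) : ℝ) < 2 * p.toReal := by
    rw [finrank_euclideanSpace, Fintype.card_fin]
    push_cast
    linarith
  have hint := integrable_rpow_neg_one_add_norm_sq (E := EuclideanSpace ℝ (Fin 3))
    (μ := volume) hq
  refine hint.congr (Eventually.of_forall fun x => ?_)
  have h1 : 0 < 1 + ‖x‖ ^ 2 := by positivity
  simp only
  rw [Real.norm_eq_abs, abs_of_pos (inv_pos.2 h1), Real.inv_rpow h1.le, ← Real.rpow_neg h1.le]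
  congr 1
  ring

/-- **`U ∈ L^p(ℝ³)` for every `2 ≤ p < ∞`** (in particular `L²` and the Serrin class `L⁵`). [folklore] -/
theorem memLp_swirl {p : ℝ≥0∞} (hp : 2 ≤ p) (hp' : p ≠ ∞) : MemLp swirl p volume := by
  refine MemLp.of_le ((memLp_inv_one_add_norm_sq hp hp').const_mul 2)
    continuous_swirl.aestronglyMeasurable (Eventually.of_forall fun x => ?_)
  rw [Real.norm_eq_abs, abs_of_pos (by positivity)]
  exact norm_swirl_le x

/-- The derivative of `U` (Leibniz rule). [folklore] -/
theorem hasFDerivAt_swirl (x : EuclideanSpace ℝ (Fin 3)) :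
    HasFDerivAt swirl (env x • (rotJ : EuclideanSpace ℝ (Fin 3) →L[ℝ] EuclideanSpace ℝ (Fin 3)) +
      (fderiv ℝ env x).smulRight (rotJ x)) x :=
  (hasFDerivAt_env x).differentiableAt.hasFDerivAt.smul rotJ.hasFDerivAt

/-- **`‖DU(x)‖ ≤ 10 (1+|x|²)⁻²`.** [folklore] -/
theorem norm_fderiv_swirl_le (x : EuclideanSpace ℝ (Fin 3)) :
    ‖fderiv ℝ swirl x‖ ≤ 10 * ((1 + ‖x‖ ^ 2) ^ 2)⁻¹ := by
  rw [(hasFDerivAt_swirl x).fderiv]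
  have hr : 0 < 1 + ‖x‖ ^ 2 := by positivity
  have hJ : ‖(rotJ : EuclideanSpace ℝ (Fin 3) →L[ℝ] EuclideanSpace ℝ (Fin 3))‖ ≤ 2 :=
    ContinuousLinearMap.opNorm_le_bound _ zero_le_two norm_rotJ_le
  have hx2 : ‖x‖ ^ 2 ≤ 1 + ‖x‖ ^ 2 := by linarith
  have h1 : ‖env x • (rotJ : EuclideanSpace ℝ (Fin 3) →L[ℝ] EuclideanSpace ℝ (Fin 3))‖ ≤
      2 * ((1 + ‖x‖ ^ 2) ^ 2)⁻¹ := by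
    rw [norm_smul, Real.norm_eq_abs, abs_of_pos (env_pos x), env]
    calc ((1 + ‖x‖ ^ 2) ^ 2)⁻¹ * ‖(rotJ : EuclideanSpace ℝ (Fin 3) →L[ℝ] EuclideanSpace ℝ (Fin 3))‖
        ≤ ((1 + ‖x‖ ^ 2) ^ 2)⁻¹ * 2 := mul_le_mul_of_nonneg_left hJ (by positivity)
      _ = 2 * ((1 + ‖x‖ ^ 2) ^ 2)⁻¹ := mul_comm _ _
  have h2 : ‖(fderiv ℝ env x).smulRight (rotJ x)‖ ≤ 8 * ((1 + ‖x‖ ^ 2) ^ 2)⁻¹ := by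
    rw [ContinuousLinearMap.norm_smulRight_apply]
    calc ‖fderiv ℝ env x‖ * ‖rotJ x‖ ≤ (4 * ‖x‖ / (1 + ‖x‖ ^ 2) ^ 3) * (2 * ‖x‖) :=
          mul_le_mul (norm_fderiv_env_le x) (norm_rotJ_le x) (norm_nonneg _) (by positivity)
      _ = 8 * ‖x‖ ^ 2 / (1 + ‖x‖ ^ 2) ^ 3 := by ring
      _ ≤ 8 * (1 + ‖x‖ ^ 2) / (1 + ‖x‖ ^ 2) ^ 3 := by gcongr
      _ = 8 * ((1 + ‖x‖ ^ 2) ^ 2)⁻¹ := by field_simp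
  calc _ ≤ _ := norm_add_le _ _
    _ ≤ 2 * ((1 + ‖x‖ ^ 2) ^ 2)⁻¹ + 8 * ((1 + ‖x‖ ^ 2) ^ 2)⁻¹ := add_le_add h1 h2
    _ = 10 * ((1 + ‖x‖ ^ 2) ^ 2)⁻¹ := by ring

/-- The Frobenius norm is homogeneous of degree two. [folklore] -/
theorem frobeniusNormSq_smul (c : ℝ) (L : EuclideanSpace ℝ (Fin 3) →L[ℝ] EuclideanSpace ℝ (Fin 3)) :
    frobeniusNormSq (c • L) = c ^ 2 * frobeniusNormSq L := by
  unfold frobeniusNormSq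
  rw [Finset.mul_sum]
  refine Finset.sum_congr rfl fun i _ => ?_
  simp only [_root_.FunLike.coe_smul, Pi.smul_apply, norm_smul, mul_pow, Real.norm_eq_abs,
    sq_abs]

/-- The Frobenius norm is nonnegative. [folklore] -/
theorem frobeniusNormSq_nonneg' (L : EuclideanSpace ℝ (Fin 3) →L[ℝ] EuclideanSpace ℝ (Fin 3)) :
    0 ≤ frobeniusNormSq L :=
  Finset.sum_nonneg fun _ _ => sq_nonneg _

/-- **`∇U ∈ L²`**: the dissipation `∫ |DU|² dx` is finite (`|DU|² ≤ 300 (1+|x|²)⁻⁴`). [folklore] -/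
theorem lintegral_frob_fderiv_swirl_lt_top :
    ∫⁻ x, ENNReal.ofReal (frobeniusNormSq (fderiv ℝ swirl x)) < ∞ := by
  have hq : ((Module.finrank ℝ (EuclideanSpace ℝ (Fin 3)) : ℕ) : ℝ) < 8 := by
    rw [finrank_euclideanSpace, Fintype.card_fin]; norm_num
  have hint := (integrable_rpow_neg_one_add_norm_sq (E := EuclideanSpace ℝ (Fin 3))
    (μ := volume) hq).const_mul 300
  refine lt_of_le_of_lt (lintegral_mono fun x => ?_) hint.lintegral_lt_top
  refine ENNReal.ofReal_le_ofReal ?_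
  have h1 : 0 < 1 + ‖x‖ ^ 2 := by positivity
  have hpow : (1 + ‖x‖ ^ 2) ^ (-(8 : ℝ) / 2) = ((1 + ‖x‖ ^ 2) ^ 4)⁻¹ := by
    rw [show (-(8 : ℝ) / 2) = -((4 : ℕ) : ℝ) by norm_num, Real.rpow_neg h1.le, Real.rpow_natCast]
  rw [hpow]
  calc frobeniusNormSq (fderiv ℝ swirl x) ≤ 3 * ‖fderiv ℝ swirl x‖ ^ 2 :=
          BradshawTsai2017.frobeniusNormSq_le_three_mul_norm_sq _
    _ ≤ 3 * (10 * ((1 + ‖x‖ ^ 2) ^ 2)⁻¹) ^ 2 := by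
        gcongr
        exact norm_fderiv_swirl_le x
    _ = 300 * ((1 + ‖x‖ ^ 2) ^ 4)⁻¹ := by
        rw [mul_pow, inv_pow, ← pow_mul]
        ring

/-- The envelope has unit `L²` mass at least: `∫ ⟪U, U⟫ > 0`. [folklore] -/
theorem integral_inner_swirl_swirl_pos :
    0 < ∫ x, ⟪swirl x, swirl x⟫ := by
  have hnn : 0 ≤ fun x => ⟪swirl x, swirl x⟫ := fun x => real_inner_self_nonneg
  rw [integral_pos_iff_support_of_nonneg hnn
    (integrable_inner_of_memLp_two (memLp_swirl le_rfl (by simp)) (memLp_swirl le_rfl (by simp)))]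
  have hopen : IsOpen (Function.support fun x => ⟪swirl x, swirl x⟫) :=
    (continuous_swirl.inner continuous_swirl).isOpen_support
  refine hopen.measure_pos volume ⟨e 0, ?_⟩
  rw [Function.mem_support]
  exact fun h0 => swirl_e0_ne_zero (inner_self_eq_zero.1 h0)

end Summit.NavierStokesRegularity.ForcedUniquenessCountableJunk

end
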